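import Literature.Probability.RandomPlanarGeometry.BubbleHittingHarmonic
import Literature.Probability.Process.BrownianVecHitFrom
import HarnessLib

/-!
# The Brownian bubble hitting masses: `E[𝟙{τ_A < ∞} |W_{τ_A}|⁻²] = −SΦ_A(0)/6` for a four-dimensional Brownian motion

Proof file (small definitions with bodies, theorems; no named fact), after

* G. F. Lawler, O. Schramm, W. Werner, *Conformal restriction: the chordal case*, J. Amer. Math.
  Soc. **16** (2003) 917–955, arXiv:math/0209343 (**[LSW]**), §7.1 eq. (7.2): for the Brownian
  bubble measure `μ` at `0` and `A ∈ 𝒬*`, "`μ[K ∩ A ≠ ∅] = −S g_A(0)/6`"; §7.1 second bullet (the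
  bubble as Brownian bridge + Itô excursion, i.e. — lifted to `ℝ⁴` as the tree lifts §4 — a
  four-dimensional Brownian loop from `0`); §4 p. 16 (Bessel-3 = modulus of Brownian motion in `ℝ³`).

THE PROBABILISTIC HALF of (7.2) for the lifted construction: for `A ∈ 𝒬*` and ANY
four-dimensional Brownian motion `W` from `0` (`Process.IsBrownianVec`, `d = 4`),

  `integral_bubbleHit_eq : E[𝟙{τ_A < ∞} |W_{τ_A}|⁻²] = starBubbleMass A (= −SΦ_A(0)/6)`,

`τ_A` the hitting time of the lifted hull `exPt⁻¹ A` (`bubbleHit`; also in `ℝ≥0∞` form,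
`lintegral_bubbleHit_eq`). Combined with the `h`-transform density of the Brownian loop measure
at `0` in `ℝ⁴` (`Process/BrownianLoopDensity4`: observed up to a stopping time the loop measure is
Wiener measure weighted by `|W|⁻²`), this is the hitting mass `μ(hit A) = −SΦ_A(0)/6` of the
bubble measure obtained by folding the loops into `ℍ`.

Proof (the analytic input is `BubbleHittingHarmonic`: `ψ_A = |z|⁻² − Im(−d/Φ_A)/Im z` is bounded
and harmonic on `D_A`, `→ |z_q|⁻²` at the lifted hull, `→ 0` at `∞`, `→ −SΦ_A(0)/6` at `0`):

1. `integral_indicator_psiBar_stopped_sub_eq_zero` — for `s₀ ≤ t` and the obstacles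
   `F_η = {dist(·, exPt⁻¹A) ≤ η} ∪ {|w| ≤ η}`: `E[𝟙{W_{s₀} ∉ F_η}(ψ̄(W_{t∧τ'}) − ψ̄(W_{s₀}))] = 0`
   (`Process/BrownianVecHitFrom`: optional stopping between `s₀` and the hitting time `τ'` of
   `F_η` after `s₀`, far field exhausted by dominated convergence) — no Markov property;
2. `tendsto_stoppedProcess_psiBar`, `integral_hitFunctional_eq` — along `η_k = 1/(k+1) → 0`,
   `t_k = s₀ + k`, path by path (off the axis after `s₀`, `|w| → ∞`: almost every path) the
   stopped values tend to `𝟙{τ < ∞}|W_τ|⁻²` (hitting from `s₀`), so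
   `E[𝟙{τ_{s₀}<∞, W_{s₀} ∈ D_A}|W_{τ_{s₀}}|⁻²] = E ψ̄(W_{s₀})` for every `s₀ > 0`;
3. `integral_bubbleHit_eq` — `s₀ = 1/(j+1) → 0`: `W_{s₀} → 0` inside `D_A` so
   `E ψ̄(W_{s₀}) → −SΦ_A(0)/6`, while the hitting functionals from `s₀` are eventually the one
   from `0`.

## References

* [LSW] §7.1 (7.2) and second bullet (p. 28); §4 p. 16. [LawlerSchrammWerner2003Restriction]
* J.-F. Le Gall, *Brownian Motion, Martingales, and Stochastic Calculus* (2016), Ch. 7 §7.2,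
  Prop. 7.16, Thm. 7.17. [Legall2016]
-/

noncomputable section

namespace Literature.Probability.Process.IsBrownianVec

open MeasureTheory Filter Set
open scoped NNReal

variable {Ω : Type*} {mΩ : MeasurableSpace Ω} {P : Measure Ω} {d : ℕ} {W : ℝ≥0 → Ω → (Fin d → ℝ)}

/-! ### Two more facts on `hitFrom` (complements to `Process/BrownianVecHitFrom`) -/

/-- Later starts give later hitting times (closed `F`, continuous paths). [folklore] -/
theorem hitFrom_mono_start (hW : IsBrownianVec W P) {F : Set (Fin d → ℝ)} (hF : IsClosed F)
    {s s' : ℝ≥0} (hss' : s ≤ s') (ω : Ω) : hitFrom W F s ω ≤ hitFrom W F s' ω := by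
  induction h : hitFrom W F s' ω with
  | top => exact le_top
  | coe T =>
    have hmem : W T ω ∈ F := hW.mem_of_hitFrom_eq_coe hF h
    have hT : (s' : WithTop ℝ≥0) ≤ T := by rw [← h]; exact le_hitFrom F s' ω
    exact hitFrom_le_of_mem (hss'.trans (by exact_mod_cast hT)) hmem

/-- If `G` is not visited on `[s₀, t]`, stopping at `t ∧ τ_{F ∪ G}` is stopping at `t ∧ τ_F`
(hitting times after `s₀`). [folklore] -/
theorem min_hitFrom_union_eq (hW : IsBrownianVec W P) {F G : Set (Fin d → ℝ)} (hF : IsClosed F)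
    (hG : IsClosed G) {s₀ t : ℝ≥0} {ω : Ω} (hnot : ∀ s ≤ t, s₀ ≤ s → W s ω ∉ G) :
    min (t : WithTop ℝ≥0) (hitFrom W (F ∪ G) s₀ ω) = min (t : WithTop ℝ≥0) (hitFrom W F s₀ ω) := by
  have hle : hitFrom W (F ∪ G) s₀ ω ≤ hitFrom W F s₀ ω := hitFrom_anti Set.subset_union_left s₀ ω hW hF
  by_cases h : hitFrom W (F ∪ G) s₀ ω ≤ t
  · obtain ⟨T, hT⟩ := WithTop.ne_top_iff_exists.1 (ne_top_of_le_ne_top WithTop.coe_ne_top h)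
    have hmem : W T ω ∈ F ∪ G := hW.mem_of_hitFrom_eq_coe (hF.union hG) hT.symm
    have hTt : T ≤ t := by rw [← hT] at h; exact_mod_cast h
    have hTs : s₀ ≤ T := by
      have := le_hitFrom (W := W) (F ∪ G) s₀ ω
      rw [← hT] at this; exact_mod_cast this
    have hmemF : W T ω ∈ F := hmem.resolve_right (hnot T hTt hTs)
    have hge : hitFrom W F s₀ ω ≤ T := hitFrom_le_of_mem hTs hmemF
    have heq : hitFrom W (F ∪ G) s₀ ω = hitFrom W F s₀ ω := le_antisymm hle (hT ▸ hge)
    rw [heq]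
  · push Not at h
    rw [min_eq_left h.le, min_eq_left (h.le.trans hle)]

end Literature.Probability.Process.IsBrownianVec


namespace Literature.Probability.RandomPlanarGeometry

open MeasureTheory Filter Set Metric
open _root_.Topology
open UpperHalfPlane (upperHalfPlaneSet)
open Literature.Probability.Process Literature.Probability.Process.IsBrownianVec
open scoped NNReal ENNReal

variable {Ω : Type*} {mΩ : MeasurableSpace Ω} {P : Measure Ω} {W : ℝ≥0 → Ω → (Fin 4 → ℝ)} {A : Set ℂ}

/-- The obstacles `F_η = {dist(·, exPt⁻¹ A) ≤ η} ∪ {|w| ≤ η}` (as in `BrownianExcursionRestriction`). [folklore] -/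
def bubbleObstacle (A : Set ℂ) (η : ℝ) : Set (Fin 4 → ℝ) :=
  {p : Fin 4 → ℝ | infDist p (exPt ⁻¹' A) ≤ η} ∪ {p | exRad p ≤ η}

/-- `‖exPt p‖² = sqSum p` (`|x + i|w||² = x² + |w|²`). [folklore] -/
theorem normSq_exPt (p : Fin 4 → ℝ) : Complex.normSq (exPt p) = sqSum p := by
  rw [Complex.normSq_apply, exPt_re, exPt_im, ← sq, ← sq, exRad_sq, exSq, sqSum, Fin.sum_univ_four]
  ring

/-- `‖exPt p‖ ≤ 2‖p‖`. [folklore] -/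
theorem norm_exPt_le (p : Fin 4 → ℝ) : ‖exPt p‖ ≤ 2 * ‖p‖ := by
  have h0 : |p 0| ≤ ‖p‖ := by rw [← Real.norm_eq_abs]; exact norm_le_pi_norm p 0
  have h1 : |p 1| ≤ ‖p‖ := by rw [← Real.norm_eq_abs]; exact norm_le_pi_norm p 1
  have h2 : |p 2| ≤ ‖p‖ := by rw [← Real.norm_eq_abs]; exact norm_le_pi_norm p 2
  have h3 : |p 3| ≤ ‖p‖ := by rw [← Real.norm_eq_abs]; exact norm_le_pi_norm p 3
  have hn : 0 ≤ ‖p‖ := norm_nonneg p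
  have hsq : ‖exPt p‖ ^ 2 ≤ (2 * ‖p‖) ^ 2 := by
    rw [← Complex.normSq_eq_norm_sq, normSq_exPt, sqSum, Fin.sum_univ_four]
    nlinarith [sq_abs (p 0), sq_abs (p 1), sq_abs (p 2), sq_abs (p 3), abs_nonneg (p 0),
      abs_nonneg (p 1), abs_nonneg (p 2), abs_nonneg (p 3)]
  exact (pow_le_pow_iff_left₀ (norm_nonneg _) (by positivity) two_ne_zero).1 hsq

section Setup

/-- The obstacles are closed. [folklore] -/
theorem isClosed_bubbleObstacle (A : Set ℂ) (η : ℝ) : IsClosed (bubbleObstacle A η) :=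
  isClosed_obstacle A η

/-- The lifted hull lies in every obstacle (`η ≥ 0`). [folklore] -/
theorem preimage_subset_bubbleObstacle (A : Set ℂ) {η : ℝ} (hη : 0 ≤ η) : exPt ⁻¹' A ⊆ bubbleObstacle A η :=
  preimage_subset_obstacle A hη

/-- The obstacles decrease with `η`. [folklore] -/
theorem bubbleObstacle_mono (A : Set ℂ) {η η' : ℝ} (h : η ≤ η') : bubbleObstacle A η ⊆ bubbleObstacle A η' := by
  rintro p (hp | hp)
  · exact Or.inl (le_trans (show infDist p (exPt ⁻¹' A) ≤ η from hp) h)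
  · exact Or.inr (le_trans (show exRad p ≤ η from hp) h)

/-- A point of `D_A` is outside `F_η` for small `η > 0`. [folklore] -/
theorem exists_notMem_bubbleObstacle (hA : IsStarHull A) (hne : (exPt ⁻¹' A).Nonempty) {p : Fin 4 → ℝ} (hp : p ∈ exDom A) :
    ∃ η : ℝ, 0 < η ∧ p ∉ bubbleObstacle A η := by
  have h1 : 0 < infDist p (exPt ⁻¹' A) :=
    ((isClosed_preimage_exPt hA.1.isClosed).notMem_iff_infDist_pos hne).1 hp.2
  have h2 : 0 < exRad p := exRad_pos hp.1
  refine ⟨min (infDist p (exPt ⁻¹' A)) (exRad p) / 2, by positivity, ?_⟩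
  apply notMem_obstacle
  · have := min_le_left (infDist p (exPt ⁻¹' A)) (exRad p); linarith
  · have := min_le_right (infDist p (exPt ⁻¹' A)) (exRad p); linarith

/-- `closure (F_η)ᶜ ⊆ D_A` for `η > 0`. [folklore] -/
theorem closure_compl_bubbleObstacle_subset (hA : IsStarHull A) (hne : (exPt ⁻¹' A).Nonempty) {η : ℝ} (hη : 0 < η) :
    closure (bubbleObstacle A η)ᶜ ⊆ exDom A :=
  closure_compl_obstacle_subset hA.1.isClosed hne hη

/-- The complement of `F_η` lies in `D_A` (`η > 0`). [folklore] -/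
theorem compl_bubbleObstacle_subset (hA : IsStarHull A) (hne : (exPt ⁻¹' A).Nonempty) {η : ℝ} (hη : 0 < η) :
    (bubbleObstacle A η)ᶜ ⊆ exDom A :=
  subset_closure.trans (closure_compl_bubbleObstacle_subset hA hne hη)

end Setup

/-! ### Step 1: `E[𝟙{W_{s₀} ∉ F_η} (ψ̄(W_{t ∧ τ'}) − ψ̄(W_{s₀}))] = 0` -/

section StepOne

variable [IsProbabilityMeasure P] (hW : IsBrownianVec W P) (hA : IsStarHull A) (hne : A.Nonempty)

/-- The measurable version `ψ̄ = 𝟙_{D_A} ψ_A` of the harmonic function. [folklore] -/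
def psiBar (A : Set ℂ) (hA : IsStarHull A) : (Fin 4 → ℝ) → ℝ :=
  (exDom A).indicator (bubbleHarmonic (starRMap A hA) (starDeriv A) (starDeriv_spec hA).1)

omit [IsProbabilityMeasure P] in
/-- `ψ̄` is measurable. [folklore] -/
theorem measurable_psiBar : Measurable (psiBar A hA) := by
  classical
  have hc : ContinuousOn (bubbleHarmonic (starRMap A hA) (starDeriv A) (starDeriv_spec hA).1) (exDom A) :=
    (contDiffOn_bubbleHarmonic hA.1.isClosed).continuousOn
  have h : psiBar A hA = (exDom A).piecewise
      (bubbleHarmonic (starRMap A hA) (starDeriv A) (starDeriv_spec hA).1) 0 := by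
    ext p
    by_cases hp : p ∈ exDom A <;> simp [psiBar, hp]
  rw [h]
  exact hc.measurable_piecewise continuousOn_const (isOpen_exDom hA.1.isClosed).measurableSet

/-- `ψ̄` is bounded. [folklore] -/
theorem exists_forall_abs_psiBar_le : ∃ C : ℝ, 0 ≤ C ∧ ∀ p, |psiBar A hA p| ≤ C := by
  obtain ⟨C, hC⟩ := exists_forall_abs_bubbleHarmonic_le hA
  refine ⟨max C 0, le_max_right _ _, fun p ↦ ?_⟩
  by_cases hp : p ∈ exDom A
  · rw [psiBar, indicator_of_mem hp]; exact (hC p hp).trans (le_max_left _ _)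
  · rw [psiBar, indicator_of_notMem hp, abs_zero]; exact le_max_right _ _

include hW hne in
/-- **Step 1** (optional stopping between `s₀` and the hitting time of the obstacle, far field
exhausted): for `0 < η`, `s₀ ≤ t`,
`E[𝟙{W_{s₀} ∉ F_η} · (ψ̄(W_{t ∧ τ'}) − ψ̄(W_{s₀}))] = 0`, `τ'` the hitting time of `F_η` after `s₀`,
with the integrand integrable. [folklore] -/
theorem integral_indicator_psiBar_stopped_sub_eq_zero {η : ℝ} (hη : 0 < η) {s₀ t : ℝ≥0} (hst : s₀ ≤ t) :
    Integrable (fun ω ↦ {ω | W s₀ ω ∉ bubbleObstacle A η}.indicator (fun ω ↦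
      stoppedProcess (fun r ω ↦ psiBar A hA (W r ω)) (hitFrom W (bubbleObstacle A η) s₀) t ω -
        psiBar A hA (W s₀ ω)) ω) P ∧
    ∫ ω, {ω | W s₀ ω ∉ bubbleObstacle A η}.indicator (fun ω ↦
      stoppedProcess (fun r ω ↦ psiBar A hA (W r ω)) (hitFrom W (bubbleObstacle A η) s₀) t ω -
        psiBar A hA (W s₀ ω)) ω ∂P = 0 := by
  have hHne : (exPt ⁻¹' A).Nonempty := preimage_exPt_nonempty hA hne
  set ψ := bubbleHarmonic (starRMap A hA) (starDeriv A) (starDeriv_spec hA).1 with hψ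
  set F := bubbleObstacle A η with hFdef
  have hF : IsClosed F := isClosed_bubbleObstacle A η
  -- far-field truncations
  set G : ℕ → Set (Fin 4 → ℝ) := fun n ↦ {y | (n : ℝ) + 1 ≤ ‖y‖} with hGdef
  have hGc : ∀ n, IsClosed (G n) := fun n ↦ isClosed_le continuous_const continuous_norm
  have hFn : ∀ n, IsClosed (F ∪ G n) := fun n ↦ hF.union (hGc n)
  have hbdd : ∀ n, Bornology.IsBounded (F ∪ G n)ᶜ := fun n ↦ by
    rw [compl_union]
    refine (Metric.isBounded_closedBall (x := (0 : Fin 4 → ℝ)) (r := n + 1)).subset fun y hy ↦ ?_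
    simp only [mem_inter_iff, mem_compl_iff, hGdef, mem_setOf_eq, not_le] at hy
    rw [Metric.mem_closedBall, dist_zero_right]
    exact hy.2.le
  have hsubn : ∀ n, (F ∪ G n)ᶜ ⊆ Fᶜ := fun n ↦ compl_subset_compl.2 Set.subset_union_left
  have hclU : ∀ n, closure (F ∪ G n)ᶜ ⊆ exDom A := fun n ↦
    (closure_mono (hsubn n)).trans (closure_compl_bubbleObstacle_subset hA hHne hη)
  have hU : IsOpen (exDom A) := isOpen_exDom hA.1.isClosed
  -- Step OS2 for each `n`
  have hstep := fun n ↦ hW.integral_indicator_stoppedProcess_hitFrom_sub_eq_zero hU (V := ψ)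
    (contDiffOn_bubbleHarmonic hA.1.isClosed) (fun y hy ↦ lap_bubbleHarmonic_eq_zero hA.1.isClosed hy)
    (hFn n) (hbdd n) (hclU n) hst
  -- the integrands
  set f : ℕ → Ω → ℝ := fun n ω ↦ {ω | W s₀ ω ∉ F ∪ G n}.indicator (fun ω ↦
    stoppedProcess (fun r ω ↦ ψ (W r ω)) (hitFrom W (F ∪ G n) s₀) t ω - ψ (W s₀ ω)) ω with hfdef
  set g : Ω → ℝ := fun ω ↦ {ω | W s₀ ω ∉ F}.indicator (fun ω ↦
    stoppedProcess (fun r ω ↦ psiBar A hA (W r ω)) (hitFrom W F s₀) t ω - psiBar A hA (W s₀ ω)) ω with hgdef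
  obtain ⟨C, hC0, hC⟩ := exists_forall_abs_bubbleHarmonic_le hA |> fun ⟨C, hC⟩ ↦
    (⟨max C 0, le_max_right _ _, fun p hp ↦ (hC p hp).trans (le_max_left _ _)⟩ :
      ∃ C : ℝ, 0 ≤ C ∧ ∀ p ∈ exDom A, |ψ p| ≤ C)
  -- pointwise eventual equality `f n ω = g ω`
  have hev : ∀ ω, ∀ᶠ n : ℕ in atTop, f n ω = g ω := by
    intro ω
    obtain ⟨M, hM⟩ : ∃ M : ℝ, ∀ s ∈ Icc (0 : ℝ≥0) t, ‖W s ω‖ ≤ M := by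
      have hc : ContinuousOn (fun s : ℝ≥0 ↦ ‖W s ω‖) (Icc 0 t) := (hW.continuous_path ω).norm.continuousOn
      obtain ⟨M, hM⟩ := isCompact_Icc.bddAbove_image hc
      exact ⟨M, fun s hs ↦ hM (mem_image_of_mem _ hs)⟩
    obtain ⟨N, hN⟩ := exists_nat_ge M
    filter_upwards [eventually_ge_atTop N] with n hn
    have hnot : ∀ s ≤ t, W s ω ∉ G n := fun s hs hG ↦ by
      have h1 : (n : ℝ) + 1 ≤ ‖W s ω‖ := hG
      have h2 : ‖W s ω‖ ≤ M := hM s ⟨bot_le, hs⟩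
      have h3 : (N : ℝ) ≤ n := by exact_mod_cast hn
      linarith
    have hs₀G : W s₀ ω ∉ G n := hnot s₀ hst
    by_cases h0 : W s₀ ω ∈ F
    · have h0' : W s₀ ω ∈ F ∪ G n := Or.inl h0
      simp only [hfdef, hgdef]
      rw [indicator_of_notMem (show ω ∉ {ω | W s₀ ω ∉ F ∪ G n} from fun h ↦ h h0'),
        indicator_of_notMem (show ω ∉ {ω | W s₀ ω ∉ F} from fun h ↦ h h0)]
    · have h0' : W s₀ ω ∉ F ∪ G n := fun h ↦ h.elim h0 hs₀G
      simp only [hfdef, hgdef]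
      rw [indicator_of_mem (show ω ∈ {ω | W s₀ ω ∉ F ∪ G n} from h0'),
        indicator_of_mem (show ω ∈ {ω | W s₀ ω ∉ F} from h0)]
      -- the stopping times agree up to `t`
      have hmin : min (t : WithTop ℝ≥0) (hitFrom W (F ∪ G n) s₀ ω) = min (t : WithTop ℝ≥0) (hitFrom W F s₀ ω) :=
        hW.min_hitFrom_union_eq hF (hGc n) (fun s hs _ ↦ hnot s hs)
      simp only [stoppedProcess]
      rw [hmin]
      -- both points are in `D_A`, where `ψ̄ = ψ`
      have hmem1 : W (min (t : WithTop ℝ≥0) (hitFrom W F s₀ ω)).untopA ω ∈ exDom A := by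
        refine closure_compl_bubbleObstacle_subset hA hHne hη ?_
        refine hW.mem_closure_compl_of_le_hitFrom hF h0 t ?_ le_rfl
        · -- `s₀ ≤ σ`
          have h1 : ((s₀ : ℝ≥0) : WithTop ℝ≥0) ≤ min (t : WithTop ℝ≥0) (hitFrom W F s₀ ω) :=
            le_min (by exact_mod_cast hst) (le_hitFrom F s₀ ω)
          have h2 : min (t : WithTop ℝ≥0) (hitFrom W F s₀ ω) ≠ ⊤ :=
            ne_top_of_le_ne_top WithTop.coe_ne_top (min_le_left _ _)
          obtain ⟨m, hm⟩ := WithTop.ne_top_iff_exists.1 h2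
          rw [← hm] at h1 ⊢
          show s₀ ≤ m
          exact_mod_cast h1
      have hmem2 : W s₀ ω ∈ exDom A := compl_bubbleObstacle_subset hA hHne hη h0
      rw [psiBar, indicator_of_mem hmem1, indicator_of_mem hmem2]
  have hlim : ∀ᵐ ω ∂P, Tendsto (fun n ↦ f n ω) atTop (𝓝 (g ω)) :=
    ae_of_all _ fun ω ↦ tendsto_const_nhds.congr' ((hev ω).mono fun n hn ↦ hn.symm)
  -- domination by `2C`
  have hbound' : ∀ n ω, ‖f n ω‖ ≤ 2 * C := fun n ω ↦ by
    rw [Real.norm_eq_abs]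
    simp only [hfdef]
    by_cases h0 : W s₀ ω ∈ F ∪ G n
    · rw [indicator_of_notMem (show ω ∉ {ω | W s₀ ω ∉ F ∪ G n} from fun h ↦ h h0), abs_zero]; positivity
    · rw [indicator_of_mem (show ω ∈ {ω | W s₀ ω ∉ F ∪ G n} from h0)]
      have hmem2 : W s₀ ω ∈ exDom A := hclU n (subset_closure h0)
      have hmem1 : W (min (t : WithTop ℝ≥0) (hitFrom W (F ∪ G n) s₀ ω)).untopA ω ∈ exDom A := by
        refine hclU n (hW.mem_closure_compl_of_le_hitFrom (hFn n) h0 t ?_ le_rfl)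
        have h1 : ((s₀ : ℝ≥0) : WithTop ℝ≥0) ≤ min (t : WithTop ℝ≥0) (hitFrom W (F ∪ G n) s₀ ω) :=
          le_min (by exact_mod_cast hst) (le_hitFrom _ s₀ ω)
        have h2 : min (t : WithTop ℝ≥0) (hitFrom W (F ∪ G n) s₀ ω) ≠ ⊤ :=
          ne_top_of_le_ne_top WithTop.coe_ne_top (min_le_left _ _)
        obtain ⟨m, hm⟩ := WithTop.ne_top_iff_exists.1 h2
        rw [← hm] at h1 ⊢
        show s₀ ≤ m
        exact_mod_cast h1
      have e1 := hC _ hmem1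
      have e2 := hC _ hmem2
      simp only [stoppedProcess] at e1 ⊢
      calc |ψ (W (min (↑t) (hitFrom W (F ∪ G n) s₀ ω)).untopA ω) - ψ (W s₀ ω)|
          ≤ |ψ (W (min (↑t) (hitFrom W (F ∪ G n) s₀ ω)).untopA ω)| + |ψ (W s₀ ω)| := abs_sub _ _
        _ ≤ C + C := add_le_add e1 e2
        _ = 2 * C := by ring
  have hbound : ∀ n, ∀ᵐ ω ∂P, ‖f n ω‖ ≤ 2 * C := fun n ↦ ae_of_all _ (hbound' n)
  have hmeas : ∀ n, AEStronglyMeasurable (f n) P := fun n ↦ (hstep n).1.aestronglyMeasurable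
  have hint : ∀ n, ∫ ω, f n ω ∂P = 0 := fun n ↦ (hstep n).2
  have hlim' : ∀ ω, Tendsto (fun n ↦ f n ω) atTop (𝓝 (g ω)) := fun ω ↦
    tendsto_const_nhds.congr' ((hev ω).mono fun n hn ↦ hn.symm)
  have hgm : AEStronglyMeasurable g P := aestronglyMeasurable_of_tendsto_ae atTop hmeas hlim
  have hgbound : ∀ ω, ‖g ω‖ ≤ 2 * C := fun ω ↦
    le_of_tendsto ((continuous_norm.tendsto _).comp (hlim' ω)) (Eventually.of_forall fun n ↦ hbound' n ω)
  have hgi : Integrable g P := Integrable.mono' (integrable_const _) hgm (ae_of_all _ hgbound)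
  have hconv := tendsto_integral_of_dominated_convergence (fun _ ↦ 2 * C) hmeas (integrable_const _)
    hbound hlim
  have hzero : Tendsto (fun n ↦ ∫ ω, f n ω ∂P) atTop (𝓝 0) := by
    simp only [hint]; exact tendsto_const_nhds
  exact ⟨hgi, tendsto_nhds_unique hconv hzero⟩

end StepOne


/-! ### Step 2, pathwise: the stopped values along a good path, `η_k = 1/(k+1) → 0`, `t_k = s₀ + k → ∞` -/

section StepTwoPath

variable (hW : IsBrownianVec W P) (hA : IsStarHull A) (hne : A.Nonempty)

/-- The obstacle radii `η_k = 1/(k+1)`. [folklore] -/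
def etaSeq (k : ℕ) : ℝ := 1 / ((k : ℝ) + 1)

omit hW hA hne in
/-- `η_k > 0`. [folklore] -/
theorem etaSeq_pos (k : ℕ) : 0 < etaSeq k := by unfold etaSeq; positivity

omit hW hA hne in
/-- `η_k → 0`. [folklore] -/
theorem tendsto_etaSeq : Tendsto etaSeq atTop (𝓝 0) := tendsto_one_div_add_atTop_nhds_zero_nat

omit hW hA hne in
/-- `η_k` is antitone. [folklore] -/
theorem etaSeq_antitone : Antitone etaSeq := fun k l hkl ↦ by
  unfold etaSeq
  have h : (k : ℝ) ≤ l := by exact_mod_cast hkl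
  exact one_div_le_one_div_of_le (by positivity) (by linarith)

include hW hA hne in
/-- **The stopped values of `ψ̄` along a good path** (`W(ω)` off the axis after `s₀` and with
`|w| → ∞`, `W_{s₀} ∈ D_A`): with `F_k` the obstacles of radius `1/(k+1)` and `τ'_k` their hitting
times after `s₀`, `ψ̄(W_{(s₀+k) ∧ τ'_k}) → 𝟙{τ_{s₀} < ∞} |W_{τ_{s₀}}|⁻²`, where `τ_{s₀}` is the
hitting time of the lifted hull after `s₀`: if it is finite the stopped clocks converge to it and
the stopped points converge inside `D_A` to the hitting point, over `A ∩ ℍ`, where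
`ψ → 1/|z|²` (`tendsto_bubbleHarmonic_of_mem`); if not, the clocks tend to `∞` and `ψ → 0` along
the transient path. [folklore] -/
theorem tendsto_stoppedProcess_psiBar {s₀ : ℝ≥0} {ω : Ω}
    (hoff : ∀ s : ℝ≥0, s₀ ≤ s → exRad (W s ω) ≠ 0)
    (hfar : Tendsto (fun t ↦ exRad (W t ω)) atTop atTop) (hD : W s₀ ω ∈ exDom A) :
    Tendsto (fun k : ℕ ↦ stoppedProcess (fun r ω ↦ psiBar A hA (W r ω))
        (hitFrom W (bubbleObstacle A (etaSeq k)) s₀) (s₀ + k) ω) atTop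
      (𝓝 ({ω | hitFrom W (exPt ⁻¹' A) s₀ ω ≠ ⊤}.indicator
        (fun ω ↦ (sqSum (W (hitFrom W (exPt ⁻¹' A) s₀ ω).untopA ω))⁻¹) ω)) := by
  have hHc : IsClosed (exPt ⁻¹' A) := isClosed_preimage_exPt hA.1.isClosed
  have hHne : (exPt ⁻¹' A).Nonempty := preimage_exPt_nonempty hA hne
  set ψ := bubbleHarmonic (starRMap A hA) (starDeriv A) (starDeriv_spec hA).1 with hψ
  set H := exPt ⁻¹' A with hHdef
  set F : ℕ → Set (Fin 4 → ℝ) := fun k ↦ bubbleObstacle A (etaSeq k) with hFdef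
  have hFc : ∀ k, IsClosed (F k) := fun k ↦ isClosed_bubbleObstacle A _
  have hHF : ∀ k, H ⊆ F k := fun k ↦ preimage_subset_bubbleObstacle A (etaSeq_pos k).le
  have hXc : Continuous fun s : ℝ≥0 ↦ W s ω := hW.continuous_path ω
  -- the stopped clocks and points
  set σ : ℕ → ℝ≥0 := fun k ↦
    (min (((s₀ + k : ℝ≥0)) : WithTop ℝ≥0) (hitFrom W (F k) s₀ ω)).untopA with hσdef
  have hval : (fun k : ℕ ↦ stoppedProcess (fun r ω ↦ psiBar A hA (W r ω))
      (hitFrom W (bubbleObstacle A (etaSeq k)) s₀) (s₀ + k) ω) = fun k ↦ psiBar A hA (W (σ k) ω) := rfl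
  rw [hval]
  have hσs : ∀ k, s₀ ≤ σ k := fun k ↦ by
    have h1 : ((s₀ : ℝ≥0) : WithTop ℝ≥0) ≤ min (((s₀ + k : ℝ≥0)) : WithTop ℝ≥0) (hitFrom W (F k) s₀ ω) :=
      le_min (by exact_mod_cast le_self_add) (le_hitFrom _ s₀ ω)
    have h2 : min (((s₀ + k : ℝ≥0)) : WithTop ℝ≥0) (hitFrom W (F k) s₀ ω) ≠ ⊤ :=
      ne_top_of_le_ne_top WithTop.coe_ne_top (min_le_left _ _)
    obtain ⟨m, hm⟩ := WithTop.ne_top_iff_exists.1 h2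
    simp only [hσdef]
    rw [← hm] at h1 ⊢
    show s₀ ≤ m
    exact_mod_cast h1
  -- (a) eventually `W_{s₀} ∉ F_k`
  obtain ⟨η₀, hη₀, hη₀F⟩ := exists_notMem_bubbleObstacle hA hHne hD
  obtain ⟨k₀, hk₀⟩ := exists_nat_one_div_lt hη₀
  have hnotF : ∀ k, k₀ ≤ k → W s₀ ω ∉ F k := fun k hk hmem ↦
    hη₀F (bubbleObstacle_mono A ((etaSeq_antitone hk).trans hk₀.le) hmem)
  -- (b) the stopped points are in `D_A` for `k ≥ k₀`
  have hmemD : ∀ k, k₀ ≤ k → W (σ k) ω ∈ exDom A := fun k hk ↦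
    closure_compl_bubbleObstacle_subset hA hHne (etaSeq_pos k)
      (hW.mem_closure_compl_of_le_hitFrom (hFc k) (hnotF k hk) (s₀ + k) (hσs k) le_rfl)
  have hψb : ∀ k, k₀ ≤ k → psiBar A hA (W (σ k) ω) = ψ (W (σ k) ω) := fun k hk ↦ by
    rw [psiBar, indicator_of_mem (hmemD k hk)]
  -- (c) the clocks eventually exceed any `S` before the first visit of `H` after `s₀`
  have hL : ∀ S : ℝ≥0, s₀ ≤ S → (∀ j, s₀ ≤ j → j ≤ S → W j ω ∉ H) → ∀ᶠ k : ℕ in atTop, S ≤ σ k := by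
    intro S hS hnoH
    have hKc : IsCompact ((fun s : ℝ≥0 ↦ W s ω) '' Icc s₀ S) := isCompact_Icc.image hXc
    have hKD : (fun s : ℝ≥0 ↦ W s ω) '' Icc s₀ S ⊆ exDom A := by
      rintro _ ⟨j, hj, rfl⟩
      exact ⟨hoff j hj.1, hnoH j hj.1 hj.2⟩
    obtain ⟨N, hN⟩ := exists_nat_ge (S : ℝ)
    have hdisj := eventually_disjoint_obstacle hA.1.isClosed hHne tendsto_etaSeq hKc hKD
    filter_upwards [hdisj, eventually_ge_atTop N] with k hk1 hk2
    have hkS : S ≤ s₀ + (k : ℝ≥0) := by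
      have : (S : ℝ) ≤ k := hN.trans (by exact_mod_cast hk2)
      have h' : S ≤ (k : ℝ≥0) := by exact_mod_cast this
      exact h'.trans le_add_self
    have hnot : ∀ j, s₀ ≤ j → j ≤ S → W j ω ∉ F k := fun j hj1 hj2 ↦
      Set.disjoint_left.1 hk1 (mem_image_of_mem _ ⟨hj1, hj2⟩)
    have hSlt : (S : WithTop ℝ≥0) < hitFrom W (F k) s₀ ω := by
      by_contra hle
      push Not at hle
      obtain ⟨T, hT⟩ := WithTop.ne_top_iff_exists.1 (ne_top_of_le_ne_top WithTop.coe_ne_top hle)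
      have hmem : W T ω ∈ F k := hW.mem_of_hitFrom_eq_coe (hFc k) hT.symm
      have hTs : s₀ ≤ T := by
        have := le_hitFrom (W := W) (F k) s₀ ω
        rw [← hT] at this; exact_mod_cast this
      have hTS : T ≤ S := by rw [← hT] at hle; exact_mod_cast hle
      exact hnot T hTs hTS hmem
    show S ≤ (min (((s₀ + k : ℝ≥0)) : WithTop ℝ≥0) (hitFrom W (F k) s₀ ω)).untopA
    induction hT : hitFrom W (F k) s₀ ω with
    | top => rw [untopA_min_coe_top]; exact hkS
    | coe T' =>
      rw [untopA_min_coe_coe]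
      rw [hT] at hSlt
      exact le_min hkS (by exact_mod_cast hSlt.le)
  by_cases hT : hitFrom W H s₀ ω = ⊤
  · -- no visit of the lifted hull after `s₀`: the clocks tend to `∞` and `ψ → 0`
    rw [indicator_of_notMem (show ω ∉ {ω | hitFrom W H s₀ ω ≠ ⊤} from fun h ↦ h hT)]
    have hnoH : ∀ j, s₀ ≤ j → W j ω ∉ H := fun j hj hmem ↦ by
      have := hitFrom_ne_top_iff.2 ⟨j, hj, hmem⟩
      exact this hT
    have hσtop : Tendsto σ atTop atTop := by
      rw [Filter.tendsto_atTop]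
      intro S
      by_cases hS : s₀ ≤ S
      · exact hL S hS fun j hj _ ↦ hnoH j hj
      · exact Eventually.of_forall fun k ↦ (not_le.1 hS).le.trans (hσs k)
    have hnorm : Tendsto (fun k ↦ ‖exPt (W (σ k) ω)‖) atTop atTop :=
      tendsto_atTop_mono (fun k ↦ exRad_le_norm_exPt _) (hfar.comp hσtop)
    obtain ⟨R, hR, hRψ⟩ := exists_forall_abs_bubbleHarmonic_le_div (hd := (starDeriv_spec hA).1) hA
      (isRestrictionMap_starRMap hA)
    have hbnd : Tendsto (fun k ↦ (1 + 4 * starDeriv A) / ‖exPt (W (σ k) ω)‖ ^ 2) atTop (𝓝 0) := by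
      have h2 : Tendsto (fun k ↦ ‖exPt (W (σ k) ω)‖ ^ 2) atTop atTop :=
        (tendsto_pow_atTop two_ne_zero).comp hnorm
      exact tendsto_const_nhds.div_atTop h2
    have hev1 : ∀ᶠ k in atTop, ‖psiBar A hA (W (σ k) ω)‖ ≤ (1 + 4 * starDeriv A) / ‖exPt (W (σ k) ω)‖ ^ 2 := by
      filter_upwards [Filter.tendsto_atTop.1 hnorm R, eventually_ge_atTop k₀] with k hk1 hk2
      rw [hψb k hk2, Real.norm_eq_abs]
      exact hRψ _ (hmemD k hk2) hk1
    exact squeeze_zero_norm' hev1 hbnd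
  · -- the lifted hull is visited after `s₀`, first at `T₀`
    obtain ⟨T₀, hT₀⟩ := WithTop.ne_top_iff_exists.1 hT
    rw [indicator_of_mem (show ω ∈ {ω | hitFrom W H s₀ ω ≠ ⊤} from hT), ← hT₀, untopA_coe]
    have hT₀' : hitFrom W H s₀ ω = T₀ := hT₀.symm
    have hmemH : W T₀ ω ∈ H := hW.mem_of_hitFrom_eq_coe hHc hT₀'
    have hT₀s : s₀ ≤ T₀ := by
      have := le_hitFrom (W := W) H s₀ ω
      rw [hT₀'] at this; exact_mod_cast this
    -- the obstacle hitting times `T'_k ≤ T₀`, increasing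
    have hτle : ∀ k, hitFrom W (F k) s₀ ω ≤ T₀ := fun k ↦ by
      rw [← hT₀']; exact hitFrom_anti (hHF k) s₀ ω hW hHc
    have hτne : ∀ k, hitFrom W (F k) s₀ ω ≠ ⊤ := fun k ↦ ne_top_of_le_ne_top WithTop.coe_ne_top (hτle k)
    set T' : ℕ → ℝ≥0 := fun k ↦ (hitFrom W (F k) s₀ ω).untopA with hT'def
    have hT'eq : ∀ k, hitFrom W (F k) s₀ ω = T' k := fun k ↦ by
      show hitFrom W (F k) s₀ ω = ((hitFrom W (F k) s₀ ω).untopA : WithTop ℝ≥0)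
      rw [WithTop.untopA_eq_untop (hτne k), WithTop.coe_untop]
    have hT'le : ∀ k, T' k ≤ T₀ := fun k ↦ by
      have := hτle k; rw [hT'eq k] at this; exact_mod_cast this
    have hT's : ∀ k, s₀ ≤ T' k := fun k ↦ by
      have := le_hitFrom (W := W) (F k) s₀ ω; rw [hT'eq k] at this; exact_mod_cast this
    have hT'mem : ∀ k, W (T' k) ω ∈ F k := fun k ↦ hW.mem_of_hitFrom_eq_coe (hFc k) (hT'eq k)
    have hmonoF : ∀ k l, k ≤ l → F l ⊆ F k := fun k l hkl ↦ bubbleObstacle_mono A (etaSeq_antitone hkl)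
    have hT'mono : Monotone T' := by
      refine monotone_nat_of_le_succ fun k ↦ ?_
      have h := hitFrom_anti (hmonoF k (k + 1) (Nat.le_succ k)) s₀ ω hW (hFc (k + 1))
      rw [hT'eq k, hT'eq (k + 1)] at h
      exact_mod_cast h
    have hbdd : BddAbove (range T') := ⟨T₀, by rintro _ ⟨k, rfl⟩; exact hT'le k⟩
    set Ts : ℝ≥0 := ⨆ k, T' k with hTsdef
    have hT'lim : Tendsto T' atTop (𝓝 Ts) := tendsto_atTop_ciSup hT'mono hbdd
    have hTsle : Ts ≤ T₀ := ciSup_le hT'le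
    have hTss : s₀ ≤ Ts := (hT's 0).trans (le_ciSup hbdd 0)
    -- the limit point is on the lifted hull
    set gA : (Fin 4 → ℝ) → ℝ := fun p ↦ min (infDist p H) (exRad p) with hgAdef
    have hgAc : Continuous gA := (continuous_infDist_pt _).min continuous_exRad
    have hgAle : ∀ k, gA (W (T' k) ω) ≤ etaSeq k := fun k ↦ by
      rcases hT'mem k with h | h
      · exact (min_le_left _ _).trans h
      · exact (min_le_right _ _).trans h
    have hgAlim : Tendsto (fun k ↦ gA (W (T' k) ω)) atTop (𝓝 (gA (W Ts ω))) :=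
      ((hgAc.comp hXc).tendsto Ts).comp hT'lim
    have hgA0 : gA (W Ts ω) = 0 := by
      have h1 : gA (W Ts ω) ≤ 0 := le_of_tendsto_of_tendsto hgAlim tendsto_etaSeq (Eventually.of_forall hgAle)
      have h2 : 0 ≤ gA (W Ts ω) := le_min infDist_nonneg (exRad_nonneg _)
      exact le_antisymm h1 h2
    have hTsH : W Ts ω ∈ H := by
      rcases min_eq_iff.1 hgA0 with ⟨h, -⟩ | ⟨h, -⟩
      · exact (hHc.mem_iff_infDist_zero hHne).2 h
      · exact absurd h (hoff Ts hTss)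
    have hTseq : Ts = T₀ := by
      refine le_antisymm hTsle ?_
      have := hitFrom_le_of_mem (W := W) hTss hTsH
      rw [hT₀'] at this; exact_mod_cast this
    -- the stopped clocks are eventually `T'_k`, hence converge to `T₀`
    obtain ⟨N, hN⟩ := exists_nat_ge ((T₀ : ℝ) - s₀)
    have hσeq : ∀ k, N ≤ k → σ k = T' k := fun k hk ↦ by
      have hk' : T₀ ≤ s₀ + (k : ℝ≥0) := by
        have : (T₀ : ℝ) - s₀ ≤ k := hN.trans (by exact_mod_cast hk)
        have h2 : (T₀ : ℝ) ≤ s₀ + k := by linarith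
        exact_mod_cast h2
      simp only [hσdef]
      rw [min_eq_right ((hτle k).trans (by exact_mod_cast hk')), hT'eq k, untopA_coe]
    have hσlim : Tendsto σ atTop (𝓝 T₀) := by
      rw [← hTseq]
      refine hT'lim.congr' ?_
      filter_upwards [eventually_ge_atTop N] with k hk
      rw [hσeq k hk]
    -- the stopped points converge inside `D_A` to the hitting point `q = W_{T₀}`
    have hq : exRad (W T₀ ω) ≠ 0 := hoff T₀ hT₀s
    have hconv : Tendsto (fun k ↦ W (σ k) ω) atTop (𝓝[exDom A] (W T₀ ω)) :=
      tendsto_nhdsWithin_iff.2 ⟨(hXc.tendsto T₀).comp hσlim,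
        (eventually_ge_atTop k₀).mono fun k hk ↦ hmemD k hk⟩
    have hψlim := (tendsto_bubbleHarmonic_of_mem (hd := (starDeriv_spec hA).1) hA
      (isRestrictionMap_starRMap hA) hq hmemH).comp hconv
    rw [normSq_exPt] at hψlim
    refine hψlim.congr' ?_
    filter_upwards [eventually_ge_atTop k₀] with k hk
    rw [Function.comp_apply, hψb k hk]

end StepTwoPath


/-! ### Step 2: `E[𝟙{τ_{s₀} < ∞, W_{s₀} ∈ D_A} |W_{τ_{s₀}}|⁻²] = E[ψ̄(W_{s₀})]` for `s₀ > 0` -/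

section StepTwo

variable [IsProbabilityMeasure P] (hW : IsBrownianVec W P) (hA : IsStarHull A) (hne : A.Nonempty)

/-- The hitting functional from time `s₀`: `𝟙{τ_{s₀} < ∞, W_{s₀} ∈ D_A} · |W_{τ_{s₀}}|⁻²`. [folklore] -/
def hitFunctional (A : Set ℂ) (W : ℝ≥0 → Ω → (Fin 4 → ℝ)) (s₀ : ℝ≥0) (ω : Ω) : ℝ :=
  {ω | hitFrom W (exPt ⁻¹' A) s₀ ω ≠ ⊤ ∧ W s₀ ω ∈ exDom A}.indicator
    (fun ω ↦ (sqSum (W (hitFrom W (exPt ⁻¹' A) s₀ ω).untopA ω))⁻¹) ω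

include hW in
omit [IsProbabilityMeasure P] in
/-- **Almost every path is good**: off the axis at all positive times and transient in `|w|`.
[cite: Legall2016, Ch. 7 Prop. 7.16 and Thm. 7.17 (ii)] -/
theorem ae_good [IsProbabilityMeasure P] : ∀ᵐ ω ∂P, (∀ s : ℝ≥0, 0 < s → exRad (W s ω) ≠ 0) ∧
    Tendsto (fun t ↦ exRad (W t ω)) atTop atTop := by
  filter_upwards [hW.ae_forall_pos_spRad_pos 0, hW.ae_tendsto_spRad_atTop 0] with ω h1 h2
  simp only [zero_add] at h1 h2
  exact ⟨fun s hs ↦ (h1 s hs).ne', h2⟩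

include hW hA hne in
/-- **Step 2**: for `s₀ > 0`, the hitting functional from `s₀` is integrable and
`E[𝟙{τ_{s₀} < ∞, W_{s₀} ∈ D_A} |W_{τ_{s₀}}|⁻²] = E[ψ̄(W_{s₀})]` (Step 1 along `η_k → 0`,
`t_k → ∞`, dominated convergence with the pathwise limits of `tendsto_stoppedProcess_psiBar`).
[folklore] -/
theorem integral_hitFunctional_eq {s₀ : ℝ≥0} (hs₀ : 0 < s₀) :
    Integrable (hitFunctional A W s₀) P ∧
      ∫ ω, hitFunctional A W s₀ ω ∂P = ∫ ω, psiBar A hA (W s₀ ω) ∂P := by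
  have hHc : IsClosed (exPt ⁻¹' A) := isClosed_preimage_exPt hA.1.isClosed
  have hHne : (exPt ⁻¹' A).Nonempty := preimage_exPt_nonempty hA hne
  set H := exPt ⁻¹' A with hHdef
  set F : ℕ → Set (Fin 4 → ℝ) := fun k ↦ bubbleObstacle A (etaSeq k) with hFdef
  have hHF : ∀ k, H ⊆ F k := fun k ↦ preimage_subset_bubbleObstacle A (etaSeq_pos k).le
  obtain ⟨C, hC0, hC⟩ := exists_forall_abs_psiBar_le hA
  -- the sequences
  set X : ℕ → Ω → ℝ := fun k ω ↦ {ω | W s₀ ω ∉ F k}.indicator (fun ω ↦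
    stoppedProcess (fun r ω ↦ psiBar A hA (W r ω)) (hitFrom W (F k) s₀) (s₀ + k) ω) ω with hXdef
  set Y : ℕ → Ω → ℝ := fun k ω ↦ {ω | W s₀ ω ∉ F k}.indicator (fun ω ↦ psiBar A hA (W s₀ ω)) ω with hYdef
  have hstep : ∀ k, Integrable (X k - Y k) P ∧ ∫ ω, (X k - Y k) ω ∂P = 0 := by
    intro k
    obtain ⟨h1, h2⟩ := integral_indicator_psiBar_stopped_sub_eq_zero hW hA hne (etaSeq_pos k)
      (show s₀ ≤ s₀ + (k : ℝ≥0) from le_self_add)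
    have heq : (fun ω ↦ {ω | W s₀ ω ∉ bubbleObstacle A (etaSeq k)}.indicator (fun ω ↦
        stoppedProcess (fun r ω ↦ psiBar A hA (W r ω)) (hitFrom W (bubbleObstacle A (etaSeq k)) s₀) (s₀ + k) ω -
          psiBar A hA (W s₀ ω)) ω) = X k - Y k := by
      funext ω
      simp only [hXdef, hYdef, Pi.sub_apply, hFdef]
      by_cases h : W s₀ ω ∉ bubbleObstacle A (etaSeq k)
      · rw [indicator_of_mem (show ω ∈ {ω | W s₀ ω ∉ bubbleObstacle A (etaSeq k)} from h),
          indicator_of_mem (show ω ∈ {ω | W s₀ ω ∉ bubbleObstacle A (etaSeq k)} from h),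
          indicator_of_mem (show ω ∈ {ω | W s₀ ω ∉ bubbleObstacle A (etaSeq k)} from h)]
      · rw [indicator_of_notMem (show ω ∉ {ω | W s₀ ω ∉ bubbleObstacle A (etaSeq k)} from h),
          indicator_of_notMem (show ω ∉ {ω | W s₀ ω ∉ bubbleObstacle A (etaSeq k)} from h),
          indicator_of_notMem (show ω ∉ {ω | W s₀ ω ∉ bubbleObstacle A (etaSeq k)} from h), sub_zero]
    rw [heq] at h1 h2
    exact ⟨h1, h2⟩
  -- measurability of `Y k` and of `ψ̄(W_{s₀})`
  have hRm : Measurable fun ω ↦ psiBar A hA (W s₀ ω) := (measurable_psiBar hA).comp (hW.measurable s₀)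
  have hRi : Integrable (fun ω ↦ psiBar A hA (W s₀ ω)) P :=
    integrable_of_abs_le hRm fun ω ↦ hC _
  -- pointwise limits along good paths
  have hlimX : ∀ᵐ ω ∂P, Tendsto (fun k ↦ X k ω) atTop (𝓝 (hitFunctional A W s₀ ω)) := by
    filter_upwards [ae_good hW] with ω ⟨hoff, hfar⟩
    have hoff' : ∀ s : ℝ≥0, s₀ ≤ s → exRad (W s ω) ≠ 0 := fun s hs ↦ hoff s (hs₀.trans_le hs)
    by_cases hD : W s₀ ω ∈ exDom A
    · obtain ⟨η₀, hη₀, hη₀F⟩ := exists_notMem_bubbleObstacle hA hHne hD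
      obtain ⟨k₀, hk₀⟩ := exists_nat_one_div_lt hη₀
      have hnotF : ∀ k, k₀ ≤ k → W s₀ ω ∉ F k := fun k hk hmem ↦
        hη₀F (bubbleObstacle_mono A ((etaSeq_antitone hk).trans hk₀.le) hmem)
      have h := tendsto_stoppedProcess_psiBar hW hA hne hoff' hfar hD
      have hZ : hitFunctional A W s₀ ω = {ω | hitFrom W (exPt ⁻¹' A) s₀ ω ≠ ⊤}.indicator
          (fun ω ↦ (sqSum (W (hitFrom W (exPt ⁻¹' A) s₀ ω).untopA ω))⁻¹) ω := by
        simp only [hitFunctional]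
        by_cases hT : hitFrom W (exPt ⁻¹' A) s₀ ω ≠ ⊤
        · rw [indicator_of_mem (show ω ∈ {ω | hitFrom W (exPt ⁻¹' A) s₀ ω ≠ ⊤ ∧ W s₀ ω ∈ exDom A} from ⟨hT, hD⟩), indicator_of_mem hT]
        · rw [indicator_of_notMem (show ω ∉ {ω | hitFrom W (exPt ⁻¹' A) s₀ ω ≠ ⊤ ∧ W s₀ ω ∈ exDom A} from fun h ↦ hT h.1), indicator_of_notMem hT]
      rw [hZ]
      refine h.congr' ?_
      filter_upwards [eventually_ge_atTop k₀] with k hk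
      simp only [hXdef]
      rw [indicator_of_mem (show ω ∈ {ω | W s₀ ω ∉ F k} from hnotF k hk)]
    · -- `W_{s₀}` is on the lifted hull: everything vanishes
      have hH0 : W s₀ ω ∈ H := by
        by_contra h
        exact hD ⟨hoff' s₀ le_rfl, h⟩
      have hX0 : ∀ k, X k ω = 0 := fun k ↦ by
        simp only [hXdef]
        rw [indicator_of_notMem (show ω ∉ {ω | W s₀ ω ∉ F k} from fun h ↦ h (hHF k hH0))]
      have hZ : hitFunctional A W s₀ ω = 0 := by
        simp only [hitFunctional]
        rw [indicator_of_notMem (show ω ∉ {ω | hitFrom W (exPt ⁻¹' A) s₀ ω ≠ ⊤ ∧ W s₀ ω ∈ exDom A} from fun h ↦ hD h.2)]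
      rw [hZ]
      simp only [hX0]
      exact tendsto_const_nhds
  have hlimY : ∀ᵐ ω ∂P, Tendsto (fun k ↦ Y k ω) atTop (𝓝 (psiBar A hA (W s₀ ω))) := by
    filter_upwards [ae_good hW] with ω ⟨hoff, hfar⟩
    by_cases hD : W s₀ ω ∈ exDom A
    · obtain ⟨η₀, hη₀, hη₀F⟩ := exists_notMem_bubbleObstacle hA hHne hD
      obtain ⟨k₀, hk₀⟩ := exists_nat_one_div_lt hη₀
      have hnotF : ∀ k, k₀ ≤ k → W s₀ ω ∉ F k := fun k hk hmem ↦
        hη₀F (bubbleObstacle_mono A ((etaSeq_antitone hk).trans hk₀.le) hmem)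
      refine tendsto_const_nhds.congr' ?_
      filter_upwards [eventually_ge_atTop k₀] with k hk
      simp only [hYdef]
      rw [indicator_of_mem (show ω ∈ {ω | W s₀ ω ∉ F k} from hnotF k hk)]
    · have hH0 : W s₀ ω ∈ H := by
        by_contra h
        exact hD ⟨hoff s₀ hs₀, h⟩
      have hY0 : ∀ k, Y k ω = 0 := fun k ↦ by
        simp only [hYdef]
        rw [indicator_of_notMem (show ω ∉ {ω | W s₀ ω ∉ F k} from fun h ↦ h (hHF k hH0))]
      have hR0 : psiBar A hA (W s₀ ω) = 0 := by rw [psiBar, indicator_of_notMem hD]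
      rw [hR0]
      simp only [hY0]
      exact tendsto_const_nhds
  -- domination and dominated convergence for `X k − Y k`
  have hmeas : ∀ k, AEStronglyMeasurable (X k - Y k) P := fun k ↦ (hstep k).1.aestronglyMeasurable
  have hbound' : ∀ k ω, ‖(X k - Y k) ω‖ ≤ 2 * C := fun k ω ↦ by
    rw [Pi.sub_apply, Real.norm_eq_abs]
    have h1 : |X k ω| ≤ C := by
      simp only [hXdef]
      by_cases h : W s₀ ω ∉ F k
      · rw [indicator_of_mem (show ω ∈ {ω | W s₀ ω ∉ F k} from h)]; exact hC _
      · rw [indicator_of_notMem (show ω ∉ {ω | W s₀ ω ∉ F k} from h), abs_zero]; exact hC0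
    have h2 : |Y k ω| ≤ C := by
      simp only [hYdef]
      by_cases h : W s₀ ω ∉ F k
      · rw [indicator_of_mem (show ω ∈ {ω | W s₀ ω ∉ F k} from h)]; exact hC _
      · rw [indicator_of_notMem (show ω ∉ {ω | W s₀ ω ∉ F k} from h), abs_zero]; exact hC0
    calc |X k ω - Y k ω| ≤ |X k ω| + |Y k ω| := abs_sub _ _
      _ ≤ C + C := add_le_add h1 h2
      _ = 2 * C := by ring
  have hbound : ∀ k, ∀ᵐ ω ∂P, ‖(X k - Y k) ω‖ ≤ 2 * C := fun k ↦ ae_of_all _ (hbound' k)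
  have hlim : ∀ᵐ ω ∂P, Tendsto (fun k ↦ (X k - Y k) ω) atTop
      (𝓝 (hitFunctional A W s₀ ω - psiBar A hA (W s₀ ω))) := by
    filter_upwards [hlimX, hlimY] with ω h1 h2
    exact h1.sub h2
  have hconv := tendsto_integral_of_dominated_convergence (fun _ ↦ 2 * C) hmeas (integrable_const _)
    hbound hlim
  have hzero : ∫ ω, (hitFunctional A W s₀ ω - psiBar A hA (W s₀ ω)) ∂P = 0 := by
    refine tendsto_nhds_unique hconv ?_
    simp only [show ∀ k, ∫ ω, (X k - Y k) ω ∂P = 0 from fun k ↦ (hstep k).2]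
    exact tendsto_const_nhds
  -- integrability of the limit
  have hDm : AEStronglyMeasurable (fun ω ↦ hitFunctional A W s₀ ω - psiBar A hA (W s₀ ω)) P :=
    aestronglyMeasurable_of_tendsto_ae atTop hmeas hlim
  have hDi : Integrable (fun ω ↦ hitFunctional A W s₀ ω - psiBar A hA (W s₀ ω)) P := by
    refine Integrable.mono' (integrable_const (2 * C)) hDm ?_
    filter_upwards [hlim] with ω hω
    exact le_of_tendsto ((continuous_norm.tendsto _).comp hω) (Eventually.of_forall fun k ↦ hbound' k ω)
  have hsum : hitFunctional A W s₀ = fun ω ↦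
      (hitFunctional A W s₀ ω - psiBar A hA (W s₀ ω)) + psiBar A hA (W s₀ ω) := by
    funext ω; ring
  refine ⟨by rw [hsum]; exact hDi.add hRi, ?_⟩
  rw [hsum, integral_add hDi hRi, hzero, zero_add]

end StepTwo


/-! ### Step 3: `s₀ → 0` — the hitting mass from the origin -/

section StepThree

variable [IsProbabilityMeasure P] (hW : IsBrownianVec W P) (hA : IsStarHull A)

/-- **The bubble hitting functional** `𝟙{τ_A < ∞} |W_{τ_A}|⁻²` of a four-dimensional path from the
origin, `τ_A` the hitting time of the lifted hull `exPt⁻¹ A`. [folklore] -/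
def bubbleHit (A : Set ℂ) (W : ℝ≥0 → Ω → (Fin 4 → ℝ)) (ω : Ω) : ℝ :=
  {ω | hitFrom W (exPt ⁻¹' A) 0 ω ≠ ⊤}.indicator
    (fun ω ↦ (sqSum (W (hitFrom W (exPt ⁻¹' A) 0 ω).untopA ω))⁻¹) ω

/-- The start times `s_j = 1/(j+1)`. [folklore] -/
def startSeq (j : ℕ) : ℝ≥0 := 1 / ((j : ℝ≥0) + 1)

omit [IsProbabilityMeasure P] hW hA in
/-- `s_j > 0`. [folklore] -/
theorem startSeq_pos (j : ℕ) : 0 < startSeq j := by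
  unfold startSeq; positivity

omit [IsProbabilityMeasure P] hW hA in
/-- `s_j → 0`. [folklore] -/
theorem tendsto_startSeq : Tendsto startSeq atTop (𝓝 0) := by
  rw [← NNReal.tendsto_coe]
  have : (fun j : ℕ ↦ ((startSeq j : ℝ≥0) : ℝ)) = fun j : ℕ ↦ 1 / ((j : ℝ) + 1) := by
    funext j; simp [startSeq]
  rw [this]
  exact tendsto_one_div_add_atTop_nhds_zero_nat

omit [IsProbabilityMeasure P] hW in
/-- On the lifted hull, `|·|⁻² ≤ 1/(2r₀)²` if `B(0, 2r₀) ∩ A = ∅`. [folklore] -/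
theorem inv_sqSum_le_of_mem {r₀ : ℝ} (hr₀ : 0 < r₀) (hr : Disjoint (ball (0 : ℂ) (2 * r₀)) A)
    {q : Fin 4 → ℝ} (hq : q ∈ exPt ⁻¹' A) : 0 ≤ (sqSum q)⁻¹ ∧ (sqSum q)⁻¹ ≤ 1 / (2 * r₀) ^ 2 := by
  have h1 : 2 * r₀ ≤ ‖exPt q‖ := by
    by_contra h
    push Not at h
    exact Set.disjoint_left.1 hr (mem_ball_zero_iff.2 h) hq
  have h2 : (2 * r₀) ^ 2 ≤ sqSum q := by
    rw [← normSq_exPt, Complex.normSq_eq_norm_sq]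
    exact pow_le_pow_left₀ (by positivity) h1 2
  refine ⟨inv_nonneg.2 (sqSum_nonneg q), ?_⟩
  rw [one_div]
  exact inv_anti₀ (by positivity) h2

include hW hA in
/-- **Step 3 / the hitting mass identity (nonempty hull)**: for `A ∈ 𝒬*` nonempty and a
four-dimensional Brownian motion `W` from `0`,

  `E[𝟙{τ_A < ∞} |W_{τ_A}|⁻²] = −SΦ_A(0)/6 = starBubbleMass A`,

`τ_A` the hitting time of the lifted hull `exPt⁻¹ A`; the functional is integrable. (Step 2 at
`s₀ = 1/(j+1) → 0`: `E ψ̄(W_{s_j}) → ψ_A(0⁺) = −SΦ_A(0)/6` and the hitting functionals from `s_j`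
are eventually the one from `0`, path by path; dominated convergence.)
[cite: LawlerSchrammWerner2003Restriction, §7.1 eq. (7.2) (p. 28)] -/
theorem integral_bubbleHit_eq_of_nonempty (hne : A.Nonempty) :
    Integrable (bubbleHit A W) P ∧ ∫ ω, bubbleHit A W ω ∂P = starBubbleMass A := by
  have hHc : IsClosed (exPt ⁻¹' A) := isClosed_preimage_exPt hA.1.isClosed
  set H := exPt ⁻¹' A with hHdef
  set m := starBubbleMass A with hmdef
  set ψ := bubbleHarmonic (starRMap A hA) (starDeriv A) (starDeriv_spec hA).1 with hψ
  obtain ⟨r₀, hr₀, hr⟩ := hA.exists_disjoint_ball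
  obtain ⟨C, hC0, hC⟩ := exists_forall_abs_psiBar_le hA
  -- the sequences
  set Z : ℕ → Ω → ℝ := fun j ↦ hitFunctional A W (startSeq j) with hZdef
  set R : ℕ → Ω → ℝ := fun j ω ↦ psiBar A hA (W (startSeq j) ω) with hRdef
  have hstep : ∀ j, Integrable (Z j) P ∧ ∫ ω, Z j ω ∂P = ∫ ω, R j ω ∂P := fun j ↦
    integral_hitFunctional_eq hW hA hne (startSeq_pos j)
  have hRm : ∀ j, Measurable (R j) := fun j ↦ (measurable_psiBar hA).comp (hW.measurable _)
  have hRi : ∀ j, Integrable (R j) P := fun j ↦ integrable_of_abs_le (hRm j) fun ω ↦ hC _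
  -- bounds
  have hZb : ∀ j ω, ‖Z j ω‖ ≤ 1 / (2 * r₀) ^ 2 := fun j ω ↦ by
    rw [Real.norm_eq_abs]
    simp only [hZdef, hitFunctional]
    by_cases h : hitFrom W (exPt ⁻¹' A) (startSeq j) ω ≠ ⊤ ∧ W (startSeq j) ω ∈ exDom A
    · rw [indicator_of_mem (show ω ∈ {ω | hitFrom W (exPt ⁻¹' A) (startSeq j) ω ≠ ⊤ ∧
        W (startSeq j) ω ∈ exDom A} from h)]
      obtain ⟨T, hT⟩ := WithTop.ne_top_iff_exists.1 h.1
      have hmem : W T ω ∈ H := hW.mem_of_hitFrom_eq_coe hHc hT.symm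
      rw [← hT, untopA_coe]
      obtain ⟨h0, h1⟩ := inv_sqSum_le_of_mem hr₀ hr hmem
      rw [abs_of_nonneg h0]; exact h1
    · rw [indicator_of_notMem (show ω ∉ {ω | hitFrom W (exPt ⁻¹' A) (startSeq j) ω ≠ ⊤ ∧
        W (startSeq j) ω ∈ exDom A} from h), abs_zero]; positivity
  have hRb : ∀ j ω, ‖R j ω‖ ≤ C := fun j ω ↦ by rw [Real.norm_eq_abs]; exact hC _
  -- pointwise limits along good paths
  have hlimR : ∀ᵐ ω ∂P, Tendsto (fun j ↦ R j ω) atTop (𝓝 m) := by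
    filter_upwards [ae_good hW] with ω ⟨hoff, _hfar⟩
    have h0 : Tendsto (fun j ↦ W (startSeq j) ω) atTop (𝓝 0) := by
      have := ((hW.continuous_path ω).tendsto 0).comp tendsto_startSeq
      rwa [hW.apply_zero] at this
    have hD : ∀ᶠ j in atTop, W (startSeq j) ω ∈ exDom A := by
      have h1 : ∀ᶠ j in atTop, ‖W (startSeq j) ω‖ < r₀ := by
        have := (continuous_norm.tendsto (0 : Fin 4 → ℝ)).comp h0
        rw [norm_zero] at this
        exact (tendsto_order.1 this).2 r₀ hr₀
      filter_upwards [h1] with j hj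
      refine ⟨hoff _ (startSeq_pos j), fun hA' ↦ ?_⟩
      have : exPt (W (startSeq j) ω) ∈ ball (0 : ℂ) (2 * r₀) := by
        rw [mem_ball_zero_iff]
        exact (norm_exPt_le _).trans_lt (by linarith)
      exact Set.disjoint_left.1 hr this hA'
    have hconv : Tendsto (fun j ↦ W (startSeq j) ω) atTop (𝓝[exDom A] 0) :=
      tendsto_nhdsWithin_iff.2 ⟨h0, hD⟩
    have h := (tendsto_bubbleHarmonic_starRMap hA).comp hconv
    refine h.congr' ?_
    filter_upwards [hD] with j hj
    simp only [hRdef, Function.comp_apply, psiBar, indicator_of_mem hj]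
  have hlimZ : ∀ᵐ ω ∂P, Tendsto (fun j ↦ Z j ω) atTop (𝓝 (bubbleHit A W ω)) := by
    filter_upwards [ae_good hW] with ω ⟨hoff, _hfar⟩
    have h0 : Tendsto (fun j ↦ W (startSeq j) ω) atTop (𝓝 0) := by
      have := ((hW.continuous_path ω).tendsto 0).comp tendsto_startSeq
      rwa [hW.apply_zero] at this
    have hD : ∀ᶠ j in atTop, W (startSeq j) ω ∈ exDom A := by
      have h1 : ∀ᶠ j in atTop, ‖W (startSeq j) ω‖ < r₀ := by
        have := (continuous_norm.tendsto (0 : Fin 4 → ℝ)).comp h0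
        rw [norm_zero] at this
        exact (tendsto_order.1 this).2 r₀ hr₀
      filter_upwards [h1] with j hj
      refine ⟨hoff _ (startSeq_pos j), fun hA' ↦ ?_⟩
      have : exPt (W (startSeq j) ω) ∈ ball (0 : ℂ) (2 * r₀) := by
        rw [mem_ball_zero_iff]
        exact (norm_exPt_le _).trans_lt (by linarith)
      exact Set.disjoint_left.1 hr this hA'
    by_cases hT : hitFrom W H 0 ω = ⊤
    · -- never hit: everything vanishes
      have hZ0 : ∀ j, Z j ω = 0 := fun j ↦ by
        have hTj : hitFrom W H (startSeq j) ω = ⊤ :=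
          eq_top_iff.2 (hT ▸ hitFrom_mono_start hW hHc bot_le ω)
        simp only [hZdef, hitFunctional]
        rw [indicator_of_notMem (show ω ∉ {ω | hitFrom W (exPt ⁻¹' A) (startSeq j) ω ≠ ⊤ ∧
          W (startSeq j) ω ∈ exDom A} from fun h ↦ h.1 hTj)]
      have hB0 : bubbleHit A W ω = 0 := by
        simp only [bubbleHit]
        rw [indicator_of_notMem (show ω ∉ {ω | hitFrom W (exPt ⁻¹' A) 0 ω ≠ ⊤} from fun h ↦ h hT)]
      rw [hB0]; simp only [hZ0]; exact tendsto_const_nhds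
    · obtain ⟨T₀, hT₀⟩ := WithTop.ne_top_iff_exists.1 hT
      have hT₀' : hitFrom W H 0 ω = T₀ := hT₀.symm
      have hmemH : W T₀ ω ∈ H := hW.mem_of_hitFrom_eq_coe hHc hT₀'
      have hT₀pos : 0 < T₀ := by
        rw [pos_iff_ne_zero]
        rintro rfl
        rw [hW.apply_zero] at hmemH
        have : exPt 0 ∈ A := hmemH
        rw [show exPt 0 = 0 from Complex.ext (by simp) (by simp)] at this
        exact hA.2 this
      have hB : bubbleHit A W ω = (sqSum (W T₀ ω))⁻¹ := by
        simp only [bubbleHit]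
        rw [indicator_of_mem (show ω ∈ {ω | hitFrom W (exPt ⁻¹' A) 0 ω ≠ ⊤} from hT), ← hHdef, hT₀',
          untopA_coe]
      rw [hB]
      refine tendsto_const_nhds.congr' ?_
      have hsmall : ∀ᶠ j in atTop, startSeq j ≤ T₀ :=
        ((tendsto_order.1 tendsto_startSeq).2 T₀ hT₀pos).mono fun j hj ↦ hj.le
      filter_upwards [hsmall, hD] with j hj hjD
      have hτ : hitFrom W H (startSeq j) ω = T₀ :=
        le_antisymm (hitFrom_le_of_mem hj hmemH) (by rw [← hT₀']; exact hitFrom_mono_start hW hHc bot_le ω)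
      simp only [hZdef, hitFunctional]
      rw [indicator_of_mem (show ω ∈ {ω | hitFrom W (exPt ⁻¹' A) (startSeq j) ω ≠ ⊤ ∧
        W (startSeq j) ω ∈ exDom A} from ⟨by rw [← hHdef, hτ]; exact WithTop.coe_ne_top, hjD⟩), ← hHdef, hτ,
        untopA_coe]
  -- dominated convergence, twice
  have hZm : ∀ j, AEStronglyMeasurable (Z j) P := fun j ↦ (hstep j).1.aestronglyMeasurable
  have hconvZ := tendsto_integral_of_dominated_convergence (fun _ ↦ 1 / (2 * r₀) ^ 2) hZm
    (integrable_const _) (fun j ↦ ae_of_all _ (hZb j)) hlimZ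
  have hconvR := tendsto_integral_of_dominated_convergence (fun _ ↦ C)
    (fun j ↦ (hRi j).aestronglyMeasurable) (integrable_const _) (fun j ↦ ae_of_all _ (hRb j)) hlimR
  have hm : ∫ _ : Ω, m ∂P = m := by simp
  rw [hm] at hconvR
  have heqseq : (fun j ↦ ∫ ω, Z j ω ∂P) = fun j ↦ ∫ ω, R j ω ∂P := funext fun j ↦ (hstep j).2
  rw [heqseq] at hconvZ
  have hval : ∫ ω, bubbleHit A W ω ∂P = m := tendsto_nhds_unique hconvZ hconvR
  -- integrability of the limit
  have hBm : AEStronglyMeasurable (bubbleHit A W) P := aestronglyMeasurable_of_tendsto_ae atTop hZm hlimZ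
  have hBi : Integrable (bubbleHit A W) P := by
    refine Integrable.mono' (integrable_const (1 / (2 * r₀) ^ 2)) hBm ?_
    filter_upwards [hlimZ] with ω hω
    exact le_of_tendsto ((continuous_norm.tendsto _).comp hω) (Eventually.of_forall fun j ↦ hZb j ω)
  exact ⟨hBi, hval⟩

include hW hA in
/-- **The bubble hitting mass identity**: for every `A ∈ 𝒬*` and a four-dimensional Brownian
motion `W` from `0`, `E[𝟙{τ_A < ∞} |W_{τ_A}|⁻²] = starBubbleMass A (= −SΦ_A(0)/6)`, `τ_A` the
hitting time of the lifted hull `exPt⁻¹ A` (for `A = ∅` both sides vanish). This is [LSW] (7.2)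
`μ[K ∩ A ≠ ∅] = −Sg_A(0)/6` for the Brownian bubble measure realised as the image of the Brownian
loop measure at `0` in `ℝ⁴` (`Process/BrownianLoopDensity4`), whose hitting masses are
`E[|W_{τ}|⁻²; τ < ∞]` by the `h`-transform density. [cite: LawlerSchrammWerner2003Restriction, §7.1 eq. (7.2) (p. 28)] -/
theorem integral_bubbleHit_eq :
    Integrable (bubbleHit A W) P ∧ ∫ ω, bubbleHit A W ω ∂P = starBubbleMass A := by
  rcases A.eq_empty_or_nonempty with rfl | hne
  · have h0 : bubbleHit (∅ : Set ℂ) W = fun _ ↦ 0 := by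
      funext ω
      simp only [bubbleHit, preimage_empty]
      rw [indicator_of_notMem]
      intro h
      obtain ⟨j, -, hj⟩ := hitFrom_ne_top_iff.1 h
      exact hj
    rw [h0, starBubbleMass_empty]
    exact ⟨integrable_const _, by simp⟩
  · exact integral_bubbleHit_eq_of_nonempty hW hA hne

include hW hA in
/-- The hitting mass identity in `ℝ≥0∞` form: `∫⁻ 𝟙{τ_A < ∞} |W_{τ_A}|⁻² dP = ofReal (starBubbleMass A)`.
[cite: LawlerSchrammWerner2003Restriction, §7.1 eq. (7.2) (p. 28)] -/
theorem lintegral_bubbleHit_eq :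
    ∫⁻ ω, ENNReal.ofReal (bubbleHit A W ω) ∂P = ENNReal.ofReal (starBubbleMass A) := by
  obtain ⟨hi, hv⟩ := integral_bubbleHit_eq hW hA
  have hnn : 0 ≤ᵐ[P] bubbleHit A W := ae_of_all _ fun ω ↦ by
    simp only [bubbleHit]
    by_cases h : hitFrom W (exPt ⁻¹' A) 0 ω ≠ ⊤
    · rw [indicator_of_mem (show ω ∈ {ω | hitFrom W (exPt ⁻¹' A) 0 ω ≠ ⊤} from h)]
      exact inv_nonneg.2 (sqSum_nonneg _)
    · rw [indicator_of_notMem (show ω ∉ {ω | hitFrom W (exPt ⁻¹' A) 0 ω ≠ ⊤} from h)]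
      exact le_rfl
  rw [← hv, ofReal_integral_eq_lintegral_ofReal hi hnn]

end StepThree

end Literature.Probability.RandomPlanarGeometry

end
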